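/-
Origin: expansion seat `planner-pub-hodgecm-mc-axioms-1-g14-0`, handover #W179 2026-08-20T15:53:55Z md5 695957ae8ced (PKG 9793fca0e49e → 695957ae8ced; 90 l.; MECHANICAL (iib-R) rewrite v3.1 of the PKG file as it stands (14 token edits; rules R1x1+RX[h₂']x13)) (`HOME/mc/pub-hodgecm-mc-axioms-1-g14/revendor/kit-r55/stage55/HodgeCM/Model/Sanity/DegenerateClosureOEmpty.lean`, md5 695957ae8ced, 90 lines);
landed by the gen-22 packager (p-g22) in gate run 55 REPLACES the earlier landed copy of `HodgeCM/Model/Sanity/DegenerateClosureOEmpty.lean` (seat copy carried the packager Origin header of an earlier run (stripped)).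
-/
/-
Origin: SANITY lane `planner-pub-hodgecm-mc-sanity-1-g11-0` (unit pub-hodgecm-mc-sanity-1-g11, gen 11 of mc-sanity-1,
node SAN-26), 2026-08-20.  NEW additive KERNEL leaf `HodgeCM/Model/Sanity/DegenerateClosureOEmpty.lean` over two files
INSTALLED at RUN 41 — theta-3's (O2) `HodgeCM.Model.GoodSexticWitnessO` (`Model.not_noGoodSextic₀O`: an anisotropic good
sextic context exists for EVERY oriented family of models) and SAN-25 `HodgeCM.Model.Sanity.DegenerateClosureOR21AE`.
Imported by nothing.  KERNEL: 0 records, 0 definitions, 0 hypotheses minted, nothing cited, no instances.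
Expected `#print axioms`: ⊆ {propext, Classical.choice, Quot.sound}.
-/
import Summits.HodgeConjecture.HodgeCM.Model.GoodSexticWitnessO
import Summits.HodgeConjecture.HodgeCM.Model.Sanity.DegenerateClosureOR21AE

/-!
# SAN-26 — the ORIENTED vacuity residual of SAN-25 is REFUTED; `CdegSO` is EMPTY (the oriented SAN-15b)

MODEL-CONSTRUCTION sub-cell, SANITY lane (unit `pub-hodgecm-mc-sanity-1-g11`, node SAN-26).  KERNEL only; census leaf.

SAN-25 `perL_r21AEO_of_noGoodSexticO` closed the oriented E from the degenerate data EXACTLY modulo the oriented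
vacuity residual «no universe `(L, ι₁)` carries an anisotropic good sextic context for the model with bit `hb L ι₁`».
theta-3's RUN-41 row (O2) `Model.not_noGoodSextic₀O hb emb cover wm Theta d12 d34` refutes that residual for EVERY
oriented family; specialised to E's degenerate parameters:

* `not_noGoodSexticO_degS` — the oriented residual of SAN-25 is FALSE for every `hb hA W μ`;
* `isEmpty_CdegSO` — hence SAN-25's oriented data binder type `CdegSO` is EMPTY (its fibres over anisotropic contexts are
  empty, SAN-10b, and such a context with a good sextic `c` exists): the oriented E R20AEO / R21AEO can NOT be closed on
  degenerate data, for any bit family — the oriented reading of SAN-15b `isEmpty_CdegS`, which it recovers at a constant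
  bit (`isEmpty_CdegS_of_O`).

READING (census, MODEL-N ±0): the oriented census of SAN-25 is now COMPLETE and equal to the census of record — `C` is
the sole gatekeeper AND is uninhabited over toys; nothing about E is refuted (E's `C` is the honest `S`, not `degS`).
(The GUARDED residual of SAN-27 — canonical embedding clause — is NOT refuted here: (O2) does not control `ι₁`.)
-/

set_option autoImplicit false

noncomputable section

namespace HodgeCM
namespace Model
namespace Sanity

open HodgeCM.Universe (SideData ThetaModel AdelicThetaCore AdelicTorusCore)
open HodgeCM.PerL34 HodgeCM.PerL34.ArchC
open Literature.AlgebraicGeometry.HodgeTheory Literature.NumberTheory.Automorphic.PicardCM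
open Literature.NumberTheory.Transcendental (Arapura2012_Cor_15_4_6)
open Literature.AlgebraicGeometry.ShimuraVarieties
open HodgeCM.Model.ThetaSpace
open HodgeCM.Model.SupplyResidual

variable (hHD : exists_isReal_hodgeModel) (hI : hodgePQ_independent_of_hodgeModel)
  (h₁ : BallQuotientUniformised)  (h₃ : CMAbelianVarietyRealised)

/-- **The oriented vacuity residual of SAN-25 is FALSE** for every bit family `hb` and every `hA W μ` — theta-3's (O2)
`Model.not_noGoodSextic₀O` at E's degenerate parameters. -/
theorem not_noGoodSexticO_degS (hb : ∀ L : CMField, (L →+* ℂ) → Bool) (hA : Arapura2012_Cor_15_4_6)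
    (W : ∀ {L : CMField} {ι₁ : L →+* ℂ} (V : HermSpace3 L ι₁) (c : SeesawCtx L), WmInput V c.D)
    (μ : ∀ {L : CMField}, SeesawCtx L → Fin 4 → NumberField.InfinitePlace L → ℤ) :
    ¬ (∀ {L : CMField} {ι₁ : L →+* ℂ} (V : HermSpace3 L ι₁) (c : SeesawCtx L), IsAnisotropic L V.Hm →
        (thetaModelOf hHD hI h₁ h₃ (hb L ι₁) (embOf hHD hI h₁ h₃) (coverOf hHD hI h₁ h₃ hA)
          (wmOfInput fun V c => (W V c).zeroSK)
          (thetaOf _ (thetaClassInputOf _ (fun V c => thetaSpaceInputOf hHD hI h₁ h₃ degS V c))) (d12Of μ)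
          (d34Of μ)).GoodCtx ι₁ c →
        Module.finrank ℚ c.K ≠ 6) :=
  not_noGoodSextic₀O hHD hI h₁ h₃ hb (embOf hHD hI h₁ h₃) (coverOf hHD hI h₁ h₃ hA)
    (wmOfInput fun V c => (W V c).zeroSK)
    (thetaOf _ (thetaClassInputOf _ (fun V c => thetaSpaceInputOf hHD hI h₁ h₃ degS V c))) (d12Of μ) (d34Of μ)

/-- **`CdegSO` is EMPTY** for every bit family: the oriented E cannot be closed on degenerate data. -/
theorem isEmpty_CdegSO (hb : ∀ L : CMField, (L →+* ℂ) → Bool) (hA : Arapura2012_Cor_15_4_6)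
    (W : ∀ {L : CMField} {ι₁ : L →+* ℂ} (V : HermSpace3 L ι₁) (c : SeesawCtx L), WmInput V c.D)
    (μ : ∀ {L : CMField}, SeesawCtx L → Fin 4 → NumberField.InfinitePlace L → ℤ) :
    IsEmpty (CdegSO hHD hI h₁ h₃ hb hA W μ) :=
  ⟨fun C => not_noGoodSexticO_degS hHD hI h₁ h₃ hb hA W μ fun V c hV hc h6 =>
    (isEmpty_C_fibre_degS hHD hI h₁ h₃ V c hV).false (C V c hV hc h6)⟩

/-- At a constant bit this is SAN-15b `isEmpty_CdegS` again (same type by `cdegS_eq_cdegSO`). -/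
theorem isEmpty_CdegS_of_O (h : Bool) (hA : Arapura2012_Cor_15_4_6)
    (W : ∀ {L : CMField} {ι₁ : L →+* ℂ} (V : HermSpace3 L ι₁) (c : SeesawCtx L), WmInput V c.D)
    (μ : ∀ {L : CMField}, SeesawCtx L → Fin 4 → NumberField.InfinitePlace L → ℤ) :
    IsEmpty (CdegS hHD hI h₁ h₃ h hA W μ) :=
  isEmpty_CdegSO hHD hI h₁ h₃ (fun _ _ => h) hA W μ

end Sanity
end Model
end HodgeCM

end
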